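import Summits.ResolutionOfSingularities.ResolutionOfSingularities.Theorems.HypersurfaceCentreConstruction.Negative.CanonicalGameFalseOfMinimalMoves
import Summits.ResolutionOfSingularities.ResolutionOfSingularities.Theorems.WeightedInvariantHypersurfaceCentreAlgebraize

/-!
# `HypersurfaceCentreConstruction` — kill template, SYMMETRY CUT: only `Aut(S,(f))`-stable minimal moves, matched up to a unit

Door crux `stmt-ResolutionOfSingularities-19897`
(`Summit.ResolutionOfSingularities.ResolutionOfSingularities.Theses.WeightedInvariant.HypersurfaceCentreConstruction`, route
`ResolutionOfSingularities/WeightedInvariant`, line `local-engine`, key stub `stub_localWeightedDropEFT4S` over `LocalWeightedDropEFT3` /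
`…EFT4S`).  AUTHOR OF THE MATHEMATICS AND OF THE LEAN TEXT: res-L1-w43-idea-2 (IDEATOR 2, technique B), ROUND 6 sketch
`L/res-L1-w43-idea-2/Sketch-R6.lean` sha16 `2481b4a25f69ce15` (HOME/STATUS 2026-08-27T08:11:29Z, offered to res-type-070 for landing);
landed VERBATIM by res-type-070 (author of the (o27) templates it sharpens) — only the namespace is moved to the tree's `…/Negative/`
convention.  The sharpening was suggested by res-L1-w43-tri-1 (READ 2 of (o27), 08:01:30Z: «a J that is iso-invariant/(strat)-bound would
let a family answer fewer (Aut(S,f)-invariant filtrations only)»).  No definitions; sorry-free lemmas only.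

[OURS · L1 W4.3 · AI-produced negative knowledge, weaker than expert review; nothing here asserts anything about Hironaka's problem or
about the existence of a closed family.]

WHY.  A descent / closure census can only ever sample COORDINATE centres of a monomial-coefficient family such as tri-1's
`𝓗 = {z⁴ + M₁x²y⁴ + M₂y⁵}` (TRIAGE §15.4), while the (o27) family hypothesis `hclosed` of
`canonicalGameClause_false_of_closedMinimalFamily` (`…/Negative/CanonicalGameFalseOfMinimalMoves.lean`, p510528) must answer EVERY minimal
regular-centre admissible presented move `(P, n, u, w)` — in every regular system of parameters `u`.  Two clauses the keyed candidate
`LocalWeightedDropEFT3` ALREADY carries cut the quantifier down to what a census can see: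

* (c5)+(c12a) for `J` (`JIsoInvariant`, `JUnitInvariant`): the clause's filtration `J(S,f) = (I_m(u,w))_m` is stable under every ring
  automorphism `σ` of `S` with `σ f = v·f`, `v` a unit — so the family only has to answer moves whose weighted filtration is
  `Aut(S,(f))`-STABLE, and then the centre `P = I_1(u,w)` is `Aut(S,(f))`-stable too (`weightedMonomialIdeal_one_eq_span_pos`).  For a
  member with a 2-torus of symmetries this excludes every generic re-coordinatisation (only character coincidences survive — the census's
  declared residual gap).
* (c12a) for `ι` (`IotaUnitInvariant`): the successor only has to match a member UP TO A UNIT, `e g = v · (f₁ ⊗ 1)` — which is all a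
  normal-form computation ever certifies.

THEOREMS (all sorry-free):
* `weightedMonomialIdeal_one_eq_span_pos` — `I_1(u,w) = (u_i : w_i > 0)`: the degree-one piece IS the presented centre.
* `canonicalGameClause_false_of_closedSymmetricMinimalFamily` — (o27)'s TREE form with the move premises of `hclosed` strengthened by
  «`P` and every `I_m(u,w)` are stable under all `σ : S ≃+* S` with `σ f = v f`, `IsUnit v`» and its matching conclusion weakened to
  «`∃ v`, `IsUnit v ∧ e g = v * (f₁ ⊗ 1)`», refuting `CanonicalGameClause p ι J` for every `(ι, J)` with (c6), (c11), `JIsoInvariant J`,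
  `JUnitInvariant J`, `IotaUnitInvariant ι`.  Since the extra premises only weaken `hclosed`, (o27) is the special case `σ := 1`-free.
* `localWeightedDropEFT3_false_of_closedSymmetricMinimalFamily`, `localWeightedDropEFT4S_false_of_closedSymmetricMinimalFamily` — the
  projections to the keyed candidate and, by the by-name seam `not_eft4S_of_not_eft3` (p508387), to the registered key.
* `exists_unit_mul_of_eq` — direction of strength: an exact match is a match up to the unit `1`.

USE (for res-L1-w43-tri-1 / res-type-070 / the R6 census): a census verdict «sub-family 𝓕 ⊆ 𝓗 ∪ 𝓗′ is closed under all torus-stable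
coordinate moves with weights ≤ W, successors read at 𝔽₄-points up to units» instantiates `hclosed` of THIS theorem once (i) the weight
bound is removed by an argument, (ii) the character-coincidence re-coordinatisations are shown to give the same filtrations or answered,
(iii) the unit/normal-form identifications are made explicit isomorphisms `e`.  Items (i)–(iii) are the typer's residual, named here so
that nobody mistakes the census for the theorem.
-/

noncomputable section

open IsLocalRing AlgebraicGeometry CategoryTheory Literature.AlgebraicGeometry.Resolution
open Summit.ResolutionOfSingularities.ResolutionOfSingularities.Cruxes.HypersurfaceCentreConstruction.LocalEngine
open Summit.ResolutionOfSingularities.ResolutionOfSingularities.Theorems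

set_option linter.dupNamespace false
set_option autoImplicit false

namespace Summit.ResolutionOfSingularities.ResolutionOfSingularities.Theorems.HypersurfaceCentreConstruction.Negative

/-- **The degree-one piece of a weighted monomial filtration is the presented centre**: `I_1(u,w) = (u_i : w_i > 0)`.
(`⊇`: `u_i ∈ I_{w_i} ⊆ I_1`; `⊆`: a monomial `u^α` with `Σ w_i α_i ≥ 1` has some `w_i α_i ≥ 1`, hence the factor `u_i` with `w_i > 0`.)
[cite: Wlodarczyk2022, Lemma 2.1.12] -/
theorem weightedMonomialIdeal_one_eq_span_pos {A : Type} [CommRing A] {m : ℕ} (u : Fin m → A) (w : Fin m → ℕ) :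
    weightedMonomialIdeal u w 1 = Ideal.span {x | ∃ i, 0 < w i ∧ x = u i} := by
  apply le_antisymm
  · rw [weightedMonomialIdeal, Ideal.span_le]
    rintro x ⟨α, hα, rfl⟩
    -- some index carries positive weighted degree
    have hex : ∃ i, 0 < w i * α i := by
      by_contra hcon
      simp only [not_exists, not_lt, Nat.le_zero] at hcon
      have : ∑ i, w i * α i = 0 := Finset.sum_eq_zero (fun i _ => hcon i)
      omega
    obtain ⟨i, hi⟩ := hex
    have hmn : w i * α i ≠ 0 := Nat.pos_iff_ne_zero.mp hi
    have hwi : 0 < w i := Nat.pos_of_ne_zero (mul_ne_zero_iff.mp hmn).1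
    have hαi : 0 < α i := Nat.pos_of_ne_zero (mul_ne_zero_iff.mp hmn).2
    have hui : u i ∈ Ideal.span {x | ∃ i, 0 < w i ∧ x = u i} := Ideal.subset_span ⟨i, hwi, rfl⟩
    have hsplit : ∏ j, u j ^ α j = u i ^ α i * ∏ j ∈ Finset.univ.erase i, u j ^ α j :=
      (Finset.mul_prod_erase Finset.univ (fun j => u j ^ α j) (Finset.mem_univ i)).symm
    rw [SetLike.mem_coe, hsplit]
    refine Ideal.mul_mem_right _ _ ?_
    obtain ⟨k, hk⟩ := Nat.exists_eq_succ_of_ne_zero (Nat.pos_iff_ne_zero.mp hαi)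
    rw [hk, pow_succ]
    exact Ideal.mul_mem_left _ _ hui
  · rw [Ideal.span_le]
    rintro x ⟨i, hwi, rfl⟩
    exact weightedMonomialIdeal_antitone u w hwi (self_mem_weightedMonomialIdeal u w i)

/-- **The symmetry cut.**  A non-empty family `F` of singular e.f.t. positions over a perfect field of characteristic `p` such that every
MINIMAL regular-centre admissible presented move `(P, n, u, w)` at a member WHOSE CENTRE AND FILTRATION ARE `Aut(S,(f))`-STABLE
(`P.map σ = P` and `(I_m(u,w)).map σ = I_m(u,w)` for every ring automorphism `σ` of `S` with `σ f = v f`, `v` a unit) has a singular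
successor off the vertex over the centre whose position is, up to a ring isomorphism AND A UNIT, an essentially smooth local pull-back of
SOME member, refutes `CanonicalGameClause p ι J` for every `(ι, J)` with (c6) `IotaIsoInvariant ι`, (c11) `IotaJEssSmoothCompatible ι J`,
(c5) `JIsoInvariant J`, (c12a) `JUnitInvariant J`, `IotaUnitInvariant ι`.  Proof: the clause's own filtration `I_m(u,w) = J(S,f)_m` is
`σ`-stable because `J(S, σ f) = J(S,f).map σ` and `J(S, v f) = J(S, f)`; the centre is its degree-one piece; the rest is (o27)'s
least-`ι`-member argument with `ι S' (v * x) = ι S' x`. [folklore] -/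
theorem canonicalGameClause_false_of_closedSymmetricMinimalFamily (p : ℕ) (ι : (R : Type) → [CommRing R] → R → Ordinal.{0})
    (J : (R : Type) → [CommRing R] → R → ℕ → Ideal R)
    (h6 : IotaIsoInvariant ι) (h11 : IotaJEssSmoothCompatible ι J) (hJ6 : JIsoInvariant J) (hJu : JUnitInvariant J)
    (hιu : IotaUnitInvariant ι)
    (k₀ : Type) [Field k₀] [CharP k₀ p] [PerfectField k₀]
    (F : (S : Type) → [CommRing S] → [Algebra k₀ S] → S → Prop)
    (hne : ∃ (S : Type) (_ : CommRing S) (_ : Algebra k₀ S) (_ : Algebra.EssFiniteType k₀ S) (_ : IsRegularLocalRing S)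
      (f : S), F S f)
    (hclosed : ∀ (S : Type) [CommRing S] [Algebra k₀ S] [Algebra.EssFiniteType k₀ S] [IsRegularLocalRing S] (f : S), F S f →
      f ≠ 0 ∧ f ∈ (maximalIdeal S) ^ 2 ∧
      ∀ (P : Ideal S) (n : ℕ) (u : Fin n → S) (w : Fin n → ℕ),
        P.IsPrime → IsRegularLocalRing (S ⧸ P) → f ∈ P →
        Ideal.span (Set.range u) = maximalIdeal S → (maximalIdeal S).spanFinrank = n → (∃ j, 0 < w j) →
        Ideal.span {x | ∃ j, 0 < w j ∧ x = u j} = P →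
        (∀ (Q : Ideal S) [Q.IsPrime], P ≤ Q →
          algebraMap S (Localization.AtPrime Q) f ∈ (maximalIdeal (Localization.AtPrime Q)) ^ 2) →
        -- the SYMMETRY premise: centre and filtration are stable under every automorphism of `(S, (f))`
        (∀ (σ : S ≃+* S) (v : S), IsUnit v → σ f = v * f →
          P.map σ = P ∧ ∀ m : ℕ, (weightedMonomialIdeal u w m).map σ = weightedMonomialIdeal u w m) →
        ∃ (𝔫 : Ideal (cobordantAlgebra' u w)) (_ : 𝔫.IsPrime),
          cobordantT' u w ∈ 𝔫 ∧ P.map (algebraMap S (cobordantAlgebra' u w)) ≤ 𝔫 ∧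
          ¬ (extReesAlgebra.vertexIdeal (weightedMonomialIdeal u w) ≤ 𝔫) ∧
          ∃ (a : ℕ) (g : cobordantAlgebra' u w),
            algebraMap S (cobordantAlgebra' u w) f = cobordantT' u w ^ a * g ∧ ¬ (cobordantT' u w ∣ g) ∧
            algebraMap (cobordantAlgebra' u w) (Localization.AtPrime 𝔫) g ∈ (maximalIdeal (Localization.AtPrime 𝔫)) ^ 2 ∧
            ∃ (S₁ : Type) (_ : CommRing S₁) (_ : Algebra k₀ S₁) (_ : Algebra.EssFiniteType k₀ S₁) (_ : IsRegularLocalRing S₁)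
              (f₁ : S₁), F S₁ f₁ ∧
              ∃ (S' : Type) (_ : CommRing S') (_ : IsRegularLocalRing S') (_ : Algebra S₁ S')
                (_ : IsLocalHom (algebraMap S₁ S')) (_ : Algebra.FormallySmooth S₁ S') (_ : Algebra.EssFiniteType S₁ S')
                (e : Localization.AtPrime 𝔫 ≃+* S') (v : S'), IsUnit v ∧
                e (algebraMap (cobordantAlgebra' u w) (Localization.AtPrime 𝔫) g) = v * algebraMap S₁ S' f₁) :
    ¬ CanonicalGameClause p ι J := by
  intro hgame
  set A : Set Ordinal.{0} := {α | ∃ (S : Type) (_ : CommRing S) (_ : Algebra k₀ S) (_ : Algebra.EssFiniteType k₀ S)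
    (_ : IsRegularLocalRing S) (f : S), F S f ∧ ι S f = α} with hA_def
  have wf : WellFounded ((· < ·) : Ordinal.{0} → Ordinal.{0} → Prop) := wellFounded_lt
  have hA : A.Nonempty := by
    obtain ⟨S, _, _, _, _, f, hF⟩ := hne
    exact ⟨ι S f, S, inferInstance, inferInstance, inferInstance, inferInstance, f, hF, rfl⟩
  obtain ⟨S, _, _, _, _, f, hF, hα⟩ := wf.min_mem A hA
  obtain ⟨hf0, hf2, hmoves⟩ := hclosed S f hF
  obtain ⟨P, hP, hPreg, hfP, -, -, n, u, w, hspan, hrank, hpos, hcentre, hJ, hadm, hdrop⟩ := hgame k₀ S f hf0 hf2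
  -- the clause's own move is `Aut(S,(f))`-equivariant: this is where (c5) and (c12a) are spent
  have hsym : ∀ (σ : S ≃+* S) (v : S), IsUnit v → σ f = v * f →
      P.map σ = P ∧ ∀ m : ℕ, (weightedMonomialIdeal u w m).map σ = weightedMonomialIdeal u w m := by
    intro σ v hv hσ
    have hfil : ∀ m : ℕ, (weightedMonomialIdeal u w m).map σ = weightedMonomialIdeal u w m := by
      intro m
      rw [hJ m, ← hJ6 S S σ f m, hσ, hJu S v f m hv]
    refine ⟨?_, hfil⟩
    have h1 := hfil 1
    rwa [weightedMonomialIdeal_one_eq_span_pos, hcentre] at h1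
  obtain ⟨𝔫, h𝔫, ht, hP𝔫, hv, a, g, hfg, hndvd, hg2, S₁, _, _, _, _, f₁, hF₁, S', _, _, _, _, _, _, e, v, hvu, he⟩ :=
    hmoves P n u w hP hPreg hfP hspan hrank hpos hcentre (fun Q _ hQ => hadm Q hQ) hsym
  have h := hdrop 𝔫 ht hP𝔫 hv a g hfg hndvd hg2
  have h1 : ι S' (e (algebraMap (cobordantAlgebra' u w) (Localization.AtPrime 𝔫) g)) =
      ι (Localization.AtPrime 𝔫) (algebraMap (cobordantAlgebra' u w) (Localization.AtPrime 𝔫) g) :=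
    h6 (Localization.AtPrime 𝔫) S' e (algebraMap (cobordantAlgebra' u w) (Localization.AtPrime 𝔫) g)
  have h2 : ι S' (algebraMap S₁ S' f₁) = ι S₁ f₁ := (h11 S₁ S' f₁).1
  have h3 : ι S' (v * algebraMap S₁ S' f₁) = ι S' (algebraMap S₁ S' f₁) := hιu S' v (algebraMap S₁ S' f₁) hvu
  rw [← h1, he, h3, h2, hα] at h
  have hmem : ι S₁ f₁ ∈ A := ⟨S₁, inferInstance, inferInstance, inferInstance, inferInstance, f₁, hF₁, rfl⟩
  exact wf.not_lt_min A hmem h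

/-- Corollary: such a family refutes the keyed candidate H2a‴ `LocalWeightedDropEFT3 p` (which carries (c5), (c6), (c11), (c12a)). [folklore] -/
theorem localWeightedDropEFT3_false_of_closedSymmetricMinimalFamily (p : ℕ)
    (k₀ : Type) [Field k₀] [CharP k₀ p] [PerfectField k₀]
    (F : (S : Type) → [CommRing S] → [Algebra k₀ S] → S → Prop)
    (hne : ∃ (S : Type) (_ : CommRing S) (_ : Algebra k₀ S) (_ : Algebra.EssFiniteType k₀ S) (_ : IsRegularLocalRing S)
      (f : S), F S f)
    (hclosed : ∀ (S : Type) [CommRing S] [Algebra k₀ S] [Algebra.EssFiniteType k₀ S] [IsRegularLocalRing S] (f : S), F S f →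
      f ≠ 0 ∧ f ∈ (maximalIdeal S) ^ 2 ∧
      ∀ (P : Ideal S) (n : ℕ) (u : Fin n → S) (w : Fin n → ℕ),
        P.IsPrime → IsRegularLocalRing (S ⧸ P) → f ∈ P →
        Ideal.span (Set.range u) = maximalIdeal S → (maximalIdeal S).spanFinrank = n → (∃ j, 0 < w j) →
        Ideal.span {x | ∃ j, 0 < w j ∧ x = u j} = P →
        (∀ (Q : Ideal S) [Q.IsPrime], P ≤ Q →
          algebraMap S (Localization.AtPrime Q) f ∈ (maximalIdeal (Localization.AtPrime Q)) ^ 2) →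
        (∀ (σ : S ≃+* S) (v : S), IsUnit v → σ f = v * f →
          P.map σ = P ∧ ∀ m : ℕ, (weightedMonomialIdeal u w m).map σ = weightedMonomialIdeal u w m) →
        ∃ (𝔫 : Ideal (cobordantAlgebra' u w)) (_ : 𝔫.IsPrime),
          cobordantT' u w ∈ 𝔫 ∧ P.map (algebraMap S (cobordantAlgebra' u w)) ≤ 𝔫 ∧
          ¬ (extReesAlgebra.vertexIdeal (weightedMonomialIdeal u w) ≤ 𝔫) ∧
          ∃ (a : ℕ) (g : cobordantAlgebra' u w),
            algebraMap S (cobordantAlgebra' u w) f = cobordantT' u w ^ a * g ∧ ¬ (cobordantT' u w ∣ g) ∧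
            algebraMap (cobordantAlgebra' u w) (Localization.AtPrime 𝔫) g ∈ (maximalIdeal (Localization.AtPrime 𝔫)) ^ 2 ∧
            ∃ (S₁ : Type) (_ : CommRing S₁) (_ : Algebra k₀ S₁) (_ : Algebra.EssFiniteType k₀ S₁) (_ : IsRegularLocalRing S₁)
              (f₁ : S₁), F S₁ f₁ ∧
              ∃ (S' : Type) (_ : CommRing S') (_ : IsRegularLocalRing S') (_ : Algebra S₁ S')
                (_ : IsLocalHom (algebraMap S₁ S')) (_ : Algebra.FormallySmooth S₁ S') (_ : Algebra.EssFiniteType S₁ S')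
                (e : Localization.AtPrime 𝔫 ≃+* S') (v : S'), IsUnit v ∧
                e (algebraMap (cobordantAlgebra' u w) (Localization.AtPrime 𝔫) g) = v * algebraMap S₁ S' f₁) :
    ¬ LocalWeightedDropEFT3 p := by
  rintro ⟨ι, J, h6, -, -, -, hJ6, h11, hgame, -, hιu, hJu⟩
  exact canonicalGameClause_false_of_closedSymmetricMinimalFamily p ι J h6 h11 hJ6 hJu hιu k₀ F hne hclosed hgame

/-- Corollary: such a family refutes the registered key H2a⁗ `LocalWeightedDropEFT4S p`, via the by-name seam `not_eft4S_of_not_eft3`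
(p508387). [folklore] -/
theorem localWeightedDropEFT4S_false_of_closedSymmetricMinimalFamily (p : ℕ)
    (k₀ : Type) [Field k₀] [CharP k₀ p] [PerfectField k₀]
    (F : (S : Type) → [CommRing S] → [Algebra k₀ S] → S → Prop)
    (hne : ∃ (S : Type) (_ : CommRing S) (_ : Algebra k₀ S) (_ : Algebra.EssFiniteType k₀ S) (_ : IsRegularLocalRing S)
      (f : S), F S f)
    (hclosed : ∀ (S : Type) [CommRing S] [Algebra k₀ S] [Algebra.EssFiniteType k₀ S] [IsRegularLocalRing S] (f : S), F S f →
      f ≠ 0 ∧ f ∈ (maximalIdeal S) ^ 2 ∧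
      ∀ (P : Ideal S) (n : ℕ) (u : Fin n → S) (w : Fin n → ℕ),
        P.IsPrime → IsRegularLocalRing (S ⧸ P) → f ∈ P →
        Ideal.span (Set.range u) = maximalIdeal S → (maximalIdeal S).spanFinrank = n → (∃ j, 0 < w j) →
        Ideal.span {x | ∃ j, 0 < w j ∧ x = u j} = P →
        (∀ (Q : Ideal S) [Q.IsPrime], P ≤ Q →
          algebraMap S (Localization.AtPrime Q) f ∈ (maximalIdeal (Localization.AtPrime Q)) ^ 2) →
        (∀ (σ : S ≃+* S) (v : S), IsUnit v → σ f = v * f →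
          P.map σ = P ∧ ∀ m : ℕ, (weightedMonomialIdeal u w m).map σ = weightedMonomialIdeal u w m) →
        ∃ (𝔫 : Ideal (cobordantAlgebra' u w)) (_ : 𝔫.IsPrime),
          cobordantT' u w ∈ 𝔫 ∧ P.map (algebraMap S (cobordantAlgebra' u w)) ≤ 𝔫 ∧
          ¬ (extReesAlgebra.vertexIdeal (weightedMonomialIdeal u w) ≤ 𝔫) ∧
          ∃ (a : ℕ) (g : cobordantAlgebra' u w),
            algebraMap S (cobordantAlgebra' u w) f = cobordantT' u w ^ a * g ∧ ¬ (cobordantT' u w ∣ g) ∧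
            algebraMap (cobordantAlgebra' u w) (Localization.AtPrime 𝔫) g ∈ (maximalIdeal (Localization.AtPrime 𝔫)) ^ 2 ∧
            ∃ (S₁ : Type) (_ : CommRing S₁) (_ : Algebra k₀ S₁) (_ : Algebra.EssFiniteType k₀ S₁) (_ : IsRegularLocalRing S₁)
              (f₁ : S₁), F S₁ f₁ ∧
              ∃ (S' : Type) (_ : CommRing S') (_ : IsRegularLocalRing S') (_ : Algebra S₁ S')
                (_ : IsLocalHom (algebraMap S₁ S')) (_ : Algebra.FormallySmooth S₁ S') (_ : Algebra.EssFiniteType S₁ S')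
                (e : Localization.AtPrime 𝔫 ≃+* S') (v : S'), IsUnit v ∧
                e (algebraMap (cobordantAlgebra' u w) (Localization.AtPrime 𝔫) g) = v * algebraMap S₁ S' f₁) :
    ¬ LocalWeightedDropEFT4S p :=
  not_eft4S_of_not_eft3 p (localWeightedDropEFT3_false_of_closedSymmetricMinimalFamily p k₀ F hne hclosed)

/-- Sanity / direction of strength: the symmetric family hypothesis is WEAKER than (o27)'s, so every (o27)-closed family is a closed
symmetric family (forget the symmetry premise, take `v := 1`).  Stated at the level of one move's conclusion. [folklore] -/
theorem exists_unit_mul_of_eq {S' T : Type} [CommRing S'] [CommRing T] (e : T ≃+* S') (x : T) (y : S') (h : e x = y) :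
    ∃ v : S', IsUnit v ∧ e x = v * y :=
  ⟨1, isUnit_one, by rw [one_mul, h]⟩

end Summit.ResolutionOfSingularities.ResolutionOfSingularities.Theorems.HypersurfaceCentreConstruction.Negative

end
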